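import Summits.AtomisticToContinuum.Crystallization.Theses.PalmUnimodularRigidity
import Literature.Probability.Process.PointStationaryLaw
import Literature.MathematicalPhysics.StatisticalMechanics.RootEnergy

/-!
# Negative knowledge for crux `MinimiserShells` (stmt-AtomisticToContinuum-9225) — HIDDEN
# DEPENDENCY on the support item `UnimodularEnergyLowerBound` (stmt-AtomisticToContinuum-9229)

`not_minimiserShells_of_not_unimodularEnergyLowerBound : ¬ UnimodularEnergyLowerBound → ¬ MinimiserShells`
(equivalently `MinimiserShells → UnimodularEnergyLowerBound`, recovered classically by the reader):
if some point-stationary `δ`-hard-core probability law `P₀` had mean root energy `E_{P₀}[h] < e*`,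
the mixture `(1 − t)·P₀ + t·δ_{δ_0}` with the LONE ROOT (point-stationary laws form a convex cone,
`IsPointStationaryLaw.add/.smul`; the lone root is point-stationary and hard-core for every `δ`) is
still minimising for small `t > 0` (`meanRootEnergy_mix_le`, including the Bochner-junk case) while
its root shell is EMPTY with probability `t` — so the crux fails.  Hence the rank-2 crux is at least
as strong as the rank-9 support item `e_uni ≥ e*` (which is not in the route's `closes` chain): a
proof of 9225 proves 9229 on the way, and a refutation of 9229 refutes 9225.
Standing disprover, gen 1; supports item stmt-AtomisticToContinuum-9225; workfile
`Cruxes/MinimiserShells/Disproof.lean` (§3).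
-/

noncomputable section

open MeasureTheory
open scoped ENNReal

namespace Summit.AtomisticToContinuum.Crystallization.Theorems.MinimiserShells.Negative.HiddenDependency

open Literature.Probability.Process
open Literature.MathematicalPhysics.StatisticalMechanics
open Literature.Geometry.DiscreteGeometry
open Summit.AtomisticToContinuum.Crystallization.Theses.PalmUnimodularRigidity
  (MinimiserShells UnimodularEnergyLowerBound)

/-- Mean root energy `E_P[h]` (the route's inlined Bochner term). -/
def meanRootEnergy (P : Measure (Measure (EuclideanSpace ℝ (Fin 3)))) : ℝ := ∫ μ, (∫ y, lennardJones ‖y‖ ∂μ) / 2 ∂P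

/-- The lone root `δ_0` has no good shell: its shell set is empty while a shell close to the FCC or
HCP pattern has twelve points. [folklore] -/
theorem not_goodShell_dirac_zero :
    ¬ (∃ a : ℝ, 9 / 10 ≤ a ∧ a ≤ 1 ∧ ∃ T : Finset (EuclideanSpace ℝ (Fin 3)),
      (↑T : Set (EuclideanSpace ℝ (Fin 3))) = {y : (EuclideanSpace ℝ (Fin 3)) | (Measure.dirac (0 : (EuclideanSpace ℝ (Fin 3)))) {y} ≠ 0 ∧ y ≠ 0 ∧ ‖y‖ ≤ 5 / 4 * a} ∧
      (ShellCloseTo (a / 100) T (Finset.image (fun v : (EuclideanSpace ℝ (Fin 3)) => a • v) fccKissingPattern) ∨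
        ShellCloseTo (a / 100) T (Finset.image (fun v : (EuclideanSpace ℝ (Fin 3)) => a • v) hcpKissingPattern))) := by
  rintro ⟨a, ha₁, -, T, hT, hclose⟩
  have ha0 : a ≠ 0 := by linarith
  have hTempty : T = ∅ := by
    rw [← Finset.coe_eq_empty, hT]
    ext y
    simp only [Set.mem_setOf_eq, Set.mem_empty_iff_false, iff_false, not_and]
    intro hy hy0
    exfalso
    apply hy
    rw [Measure.dirac_apply' _ (measurableSet_singleton y)]
    exact Set.indicator_of_notMem
      (fun h0 : (0 : (EuclideanSpace ℝ (Fin 3))) ∈ ({y} : Set (EuclideanSpace ℝ (Fin 3))) => hy0 (Set.mem_singleton_iff.1 h0).symm) _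
  have hcard : T.card = 12 := by
    rcases hclose with hc | hc
    · rw [hc.card_eq, Finset.card_image_of_injective _ (smul_right_injective (EuclideanSpace ℝ (Fin 3)) ha0),
        card_fccKissingPattern]
    · rw [hc.card_eq, Finset.card_image_of_injective _ (smul_right_injective (EuclideanSpace ℝ (Fin 3)) ha0),
        card_hcpKissingPattern]
  rw [hTempty, Finset.card_empty] at hcard
  exact absurd hcard (by norm_num)

/-- Integration against the law `δ_{δ_0}` evaluates at `δ_0` (no measurability needed: the Giry
σ-algebra separates `δ_0`, `ae_dirac_dirac_zero`). [folklore] -/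
theorem integral_dirac_dirac_zero (F : Measure (EuclideanSpace ℝ (Fin 3)) → ℝ) :
    ∫ μ, F μ ∂(Measure.dirac (Measure.dirac (0 : (EuclideanSpace ℝ (Fin 3)))) : Measure (Measure (EuclideanSpace ℝ (Fin 3)))) =
      F (Measure.dirac 0) := by
  have hae := ae_dirac_dirac_zero (G := (EuclideanSpace ℝ (Fin 3))) (measurableSet_singleton 0)
  have heq : (fun μ => F μ) =ᵐ[(Measure.dirac (Measure.dirac (0 : (EuclideanSpace ℝ (Fin 3)))) : Measure (Measure (EuclideanSpace ℝ (Fin 3))))]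
      fun _ => F (Measure.dirac 0) :=
    hae.mono fun μ hμ => by simp only [hμ]
  rw [integral_congr_ae heq]
  simp

/-- **Mixing lemma.** If `E_P[h] < θ` and `(1 − τ)·E_P[h] ≤ θ` for some `τ ∈ (0, 1)`, the mixture
`(1 − τ)·P + τ·δ_{δ_0}` has mean root energy `≤ θ` (the lone root contributes `V_LJ(0)/2 = 0`; if
the root-energy functional is not `P`-integrable both integrals are the junk value `0`).
[folklore] -/
theorem meanRootEnergy_mix_le {P : Measure (Measure (EuclideanSpace ℝ (Fin 3)))} [IsProbabilityMeasure P] {θ τ : ℝ}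
    (hτ0 : 0 < τ) (hτ1 : τ < 1) (hlt : meanRootEnergy P < θ)
    (hτE : (1 - τ) * meanRootEnergy P ≤ θ) :
    meanRootEnergy ((1 - ENNReal.ofReal τ) • P +
        ENNReal.ofReal τ • (Measure.dirac (Measure.dirac (0 : (EuclideanSpace ℝ (Fin 3)))) : Measure (Measure (EuclideanSpace ℝ (Fin 3))))) ≤
      θ := by
  set t : ℝ≥0∞ := ENNReal.ofReal τ with ht
  set Q : Measure (Measure (EuclideanSpace ℝ (Fin 3))) := Measure.dirac (Measure.dirac (0 : (EuclideanSpace ℝ (Fin 3)))) with hQ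
  set F : Measure (EuclideanSpace ℝ (Fin 3)) → ℝ := fun μ => (∫ y, lennardJones ‖y‖ ∂μ) / 2 with hF
  have ht1 : t ≤ 1 := ENNReal.ofReal_le_one.2 hτ1.le
  have ht1' : 1 - t ≠ ∞ := ne_top_of_le_ne_top ENNReal.one_ne_top tsub_le_self
  have h1t0 : 1 - t ≠ 0 := (tsub_pos_of_lt (ENNReal.ofReal_lt_one.2 hτ1)).ne'
  have hFQ0 : F (Measure.dirac 0) = 0 := by
    simp [hF, lennardJones_zero]
  by_cases hint : Integrable F P
  · have hintQ : Integrable F Q := by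
      have hae := ae_dirac_dirac_zero (G := (EuclideanSpace ℝ (Fin 3))) (measurableSet_singleton 0)
      refine (integrable_const (F (Measure.dirac 0))).congr ?_
      exact hae.mono fun μ hμ => by simp only [hμ]
    have hsplit : meanRootEnergy ((1 - t) • P + t • Q) =
        (1 - t).toReal * meanRootEnergy P + t.toReal * F (Measure.dirac 0) := by
      unfold meanRootEnergy
      rw [integral_add_measure (hint.smul_measure ht1') (hintQ.smul_measure ENNReal.ofReal_ne_top),
        integral_smul_measure, integral_smul_measure, hQ, integral_dirac_dirac_zero]
      simp only [smul_eq_mul]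
      rfl
    rw [hsplit, hFQ0, mul_zero, add_zero, ENNReal.toReal_sub_of_le ht1 ENNReal.one_ne_top,
      ENNReal.toReal_one, ENNReal.toReal_ofReal hτ0.le]
    exact hτE
  · have hint' : ¬ Integrable F ((1 - t) • P + t • Q) := by
      intro h'
      apply hint
      have h1 : Integrable F ((1 - t) • P) := h'.mono_measure (Measure.le_add_right le_rfl)
      exact (integrable_smul_measure h1t0 ht1').1 h1
    have h0 : meanRootEnergy ((1 - t) • P + t • Q) = 0 := integral_undef hint'
    have h0' : meanRootEnergy P = 0 := integral_undef hint
    rw [h0]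
    rw [h0'] at hlt
    exact hlt.le

/-- A mixing weight: if `E₀ < θ` there is `τ ∈ (0, 1)` with `(1 − τ) E₀ ≤ θ`. [folklore] -/
theorem exists_mixing_weight {E₀ θ : ℝ} (hlt : E₀ < θ) :
    ∃ τ : ℝ, 0 < τ ∧ τ < 1 ∧ (1 - τ) * E₀ ≤ θ := by
  by_cases hE0 : 0 ≤ E₀
  · exact ⟨1 / 2, by norm_num, by norm_num, by nlinarith⟩
  · replace hE0 := lt_of_not_ge hE0
    refine ⟨min (1 / 2) ((θ - E₀) / (-E₀)), lt_min (by norm_num) (div_pos (by linarith)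
      (by linarith)), (min_le_left _ _).trans_lt (by norm_num), ?_⟩
    have hle : min (1 / 2) ((θ - E₀) / (-E₀)) * (-E₀) ≤ θ - E₀ := by
      calc min (1 / 2) ((θ - E₀) / (-E₀)) * (-E₀)
          ≤ (θ - E₀) / (-E₀) * (-E₀) :=
            mul_le_mul_of_nonneg_right (min_le_right _ _) (by linarith)
        _ = θ - E₀ := div_mul_cancel₀ _ (by linarith)
    linarith [mul_neg (min (1 / 2) ((θ - E₀) / (-E₀))) E₀]

/-- **Hidden dependency: `¬ UnimodularEnergyLowerBound → ¬ MinimiserShells`** (items 9229, 9225 of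
route `PalmUnimodularRigidity`; classically `MinimiserShells → UnimodularEnergyLowerBound`).  A
point-stationary hard-core probability law with `E_P[h] < e*`, mixed with the lone root, is a
minimising point-stationary hard-core law whose root shell is empty with positive probability.
[folklore] -/
theorem not_minimiserShells_of_not_unimodularEnergyLowerBound :
    ¬ UnimodularEnergyLowerBound → ¬ MinimiserShells := by
  intro h9229 h
  apply h9229
  intro δ hδ P hP hcore hstat
  by_contra hlt
  replace hlt := lt_of_not_ge hlt
  change meanRootEnergy P < _ at hlt
  obtain ⟨τ, hτ0, hτ1, hτE⟩ := exists_mixing_weight hlt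
  set t : ℝ≥0∞ := ENNReal.ofReal τ with ht
  set Q : Measure (Measure (EuclideanSpace ℝ (Fin 3))) := Measure.dirac (Measure.dirac (0 : (EuclideanSpace ℝ (Fin 3)))) with hQ
  have haeQ := ae_dirac_dirac_zero (G := (EuclideanSpace ℝ (Fin 3))) (measurableSet_singleton 0)
  have ht0 : t ≠ 0 := by simpa [ht, ENNReal.ofReal_eq_zero, not_le] using hτ0
  have ht1 : t ≤ 1 := ENNReal.ofReal_le_one.2 hτ1.le
  haveI hP' : IsProbabilityMeasure ((1 - t) • P + t • Q) := by
    constructor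
    simp only [Measure.add_apply, Measure.smul_apply, smul_eq_mul, measure_univ, mul_one]
    exact tsub_add_cancel_of_le ht1
  have hcore' : ∀ᵐ μ ∂((1 - t) • P + t • Q), IsRootedHardCore δ μ :=
    ae_add_measure_iff.2 ⟨Measure.ae_smul_measure hcore _,
      Measure.ae_smul_measure (haeQ.mono fun μ hμ => by rw [hμ]; exact isRootedHardCore_dirac_zero δ) _⟩
  have hstat' : IsPointStationaryLaw ((1 - t) • P + t • Q) :=
    (IsPointStationaryLaw.smul _ hstat).add (isPointStationaryLaw_dirac_dirac_zero.smul _)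
  have hE' : meanRootEnergy ((1 - t) • P + t • Q) ≤ _ := meanRootEnergy_mix_le hτ0 hτ1 hlt hτE
  have hgood := h δ hδ _ hP' hcore' hstat' hE'
  have hgoodQ := (Measure.ae_ennreal_smul_measure_iff ht0).1 (ae_add_measure_iff.1 hgood).2
  obtain ⟨μ, hμg, hμe⟩ := (hgoodQ.and haeQ).exists
  rw [hμe] at hμg
  exact not_goodShell_dirac_zero hμg

/- The positive reading `MinimiserShells → UnimodularEnergyLowerBound` is deliberately NOT stated
as a declaration here (an audit would read it as a proof of item 9229); provers recover it by
`fun h => Classical.byContradiction fun h' => not_minimiserShells_of_not_unimodularEnergyLowerBound h' h`. -/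

end Summit.AtomisticToContinuum.Crystallization.Theorems.MinimiserShells.Negative.HiddenDependency
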